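import Mathlib.Geometry.Manifold.Instances.Sphere
import Mathlib.Analysis.SpecialFunctions.Complex.Circle
import Literature.Geometry.Manifold.ModelChange
import Literature.Geometry.Kaehler.ManifoldForms
import Literature.Topology.FourManifolds.SPC4Wave0
import Literature.AlgebraicTopology.SingularHomology.CircleProductKunneth
import Literature.AlgebraicTopology.SingularHomology.CompactManifoldFiniteness
import Summits.SmoothPoincare4.SmoothPoincare4.Theorems.NoGenusTwoDoor.Negative.RealProjectivePlaneBetti

/-!
# `NoGenusTwoDoor` minus non-degeneracy is false: the compact witness `ℝP² × T²`
(negative lemma for crux stmt-SmoothPoincare4-7842)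

`SymplecticOrigami.NoGenusTwoDoor` ("no closed connected symplectic 4-manifold has
`(b₁, b₂) = (2, 1)`") with the non-degeneracy hypothesis
`∀ x v, v ≠ 0 → ∃ w, s x ![v, w] ≠ 0` deleted is FALSE: the zero 2-form on the closed connected
`ℝ⁴`-charted `C^∞` 4-manifold `ℝP² × S¹ × S¹` is smooth and closed, and
`rank H₁(ℝP² × T²; ℤ) = 2`, `rank H₂(ℝP² × T²; ℤ) = 1` (`ℝP²` is rationally a point; circle Künneth
twice: Betti numbers `(1, 0, 0) ↦ (1, 1, 0) ↦ (1, 2, 1)`). So non-degeneracy (through orientability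
and `b⁺ ≥ 1`, both consequences of `s ∧ s > 0`) is load-bearing: the witness is non-orientable,
which no hypothesis of the crux other than non-degeneracy excludes. This closes the
`proof_wanted false_withoutNondegenerate` of `Cruxes/NoGenusTwoDoor/Disproof.lean` §5 (whose planned
witness was the same manifold presented as a quotient); together with
`Negative.NoncompactDoor.noGenusTwoDoor_false_without_compact` (compactness) it leaves closedness
`ds = 0` as the only deletion whose refutation needs gauge theory (the almost-complex
`(S¹ × S³) # (S¹ × S³) # ℂP²`, not formalisable in the tree).

Construction (inside the proof of `exists_compact_degenerate_door`, no new definitions): the product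
manifold `(ℝP² × S¹) × S¹` (tree `RealProjectiveSpace 2`, Mathlib `Circle`) is charted on
`ModelProd (ModelProd ℝ² ℝ¹) ℝ¹`; it is RE-CHARTED on `ℝ⁴` along the continuous linear isomorphism
`(ℝ² × ℝ¹) × ℝ¹ ≃L[ℝ] ℝ⁴` with the tree's change-of-model synonym
`Literature.Geometry.Manifold.Rechart` (`Rechart.isManifold`), exactly as the tree's `S² × S²` model
(`Literature.Barriers.SmoothPoincare4.exists_sphereProd_model`). Homology: `Rechart` is the identity
homeomorphism, `Circle ≃ₜ AddCircle 1`, Betti numbers over `ℚ` by the tree's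
`bettiNumber_prodCircle_succ/zero` and `bettiNumber_rat_RP2_*`, and `rank_ℤ = dim_ℚ`
(`bettiNumber_int_eq_rat`). Prover negative lemma (line lead c2), supports the crux item; no named
facts, no `sorry`, no definitions.
-/

noncomputable section

-- the prescribed namespace `Summit.<P>.<Sub>.…` duplicates `SmoothPoincare4` (P = Sub)
set_option linter.dupNamespace false

open scoped Manifold ContDiff Topology
open Literature.Geometry.Kaehler Literature.AlgebraicTopology.SingularHomology
  Literature.Topology.FourManifolds Literature.Geometry.Manifold

namespace Summit.SmoothPoincare4.SmoothPoincare4.Theorems.NoGenusTwoDoor.Negative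

/-! ### Betti numbers of `ℝP² × S¹` and `(ℝP² × S¹) × S¹` over `ℚ` -/

/-- All rational homology groups of `ℝP²` are finite dimensional (closed manifold). [folklore] -/
theorem finite_singularHomology_rat_RP2 (k : ℕ) :
    Module.Finite ℚ (singularHomology ℚ ℚ (RealProjectiveSpace 2) k) :=
  finite_singularHomology_of_compact_chartedSpace ℚ ℚ (d := 2) k

/-- `b₀(ℝP² × S¹; ℚ) = 1`. [folklore] -/
theorem bettiNumber_rat_RP2_prodCircle_zero :
    bettiNumber ℚ (RealProjectiveSpace 2 × AddCircle (1 : ℝ)) 0 = 1 := by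
  rw [bettiNumber_prodCircle_zero ℚ finite_singularHomology_rat_RP2, bettiNumber_rat_RP2_zero]

/-- `b₁(ℝP² × S¹; ℚ) = 1`. [folklore] -/
theorem bettiNumber_rat_RP2_prodCircle_one :
    bettiNumber ℚ (RealProjectiveSpace 2 × AddCircle (1 : ℝ)) 1 = 1 := by
  rw [bettiNumber_prodCircle_succ ℚ finite_singularHomology_rat_RP2 0, bettiNumber_rat_RP2_one,
    bettiNumber_rat_RP2_zero]

/-- `b₂(ℝP² × S¹; ℚ) = 0`. [folklore] -/
theorem bettiNumber_rat_RP2_prodCircle_two :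
    bettiNumber ℚ (RealProjectiveSpace 2 × AddCircle (1 : ℝ)) 2 = 0 := by
  rw [bettiNumber_prodCircle_succ ℚ finite_singularHomology_rat_RP2 1, bettiNumber_rat_RP2_two,
    bettiNumber_rat_RP2_one]

/-- All rational homology groups of `ℝP² × S¹` are finite dimensional. [folklore] -/
theorem finite_singularHomology_rat_RP2_prodCircle (k : ℕ) :
    Module.Finite ℚ (singularHomology ℚ ℚ (RealProjectiveSpace 2 × AddCircle (1 : ℝ)) k) :=
  finite_singularHomology_prodCircle ℚ finite_singularHomology_rat_RP2 k

/-- `b₁((ℝP² × S¹) × S¹; ℚ) = 2`. [folklore] -/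
theorem bettiNumber_rat_RP2_prodCircle_prodCircle_one :
    bettiNumber ℚ ((RealProjectiveSpace 2 × AddCircle (1 : ℝ)) × AddCircle (1 : ℝ)) 1 = 2 := by
  rw [bettiNumber_prodCircle_succ ℚ finite_singularHomology_rat_RP2_prodCircle 0,
    bettiNumber_rat_RP2_prodCircle_one, bettiNumber_rat_RP2_prodCircle_zero]

/-- `b₂((ℝP² × S¹) × S¹; ℚ) = 1`. [folklore] -/
theorem bettiNumber_rat_RP2_prodCircle_prodCircle_two :
    bettiNumber ℚ ((RealProjectiveSpace 2 × AddCircle (1 : ℝ)) × AddCircle (1 : ℝ)) 2 = 1 := by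
  rw [bettiNumber_prodCircle_succ ℚ finite_singularHomology_rat_RP2_prodCircle 1,
    bettiNumber_rat_RP2_prodCircle_two, bettiNumber_rat_RP2_prodCircle_one]

/-- `rank_ℤ Hₖ(Q; ℤ) = bₖ(Y; ℚ)` for homeomorphic `Q ≃ₜ Y` (homeomorphism invariance and
`rank_ℤ Hₖ(·; ℤ) = dim_ℚ Hₖ(·; ℚ)`, Hatcher Cor. 3A.6), in the tree's `singularHomologyZ` spelling.
[folklore] -/
theorem finrank_singularHomologyZ_eq_bettiNumber_rat_of_homeomorph {Q Y : Type}
    [TopologicalSpace Q] [TopologicalSpace Y] (φ : Q ≃ₜ Y) (k : ℕ) :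
    Module.finrank ℤ (singularHomologyZ Q k) = bettiNumber ℚ Y k := by
  have e : singularHomologyZ Q k ≃ₗ[ℤ] singularHomology ℤ ℤ Y k :=
    (singularHomology.mapIso ℤ ℤ φ k).toLinearEquiv
  rw [e.finrank_eq, ← bettiNumber_int_eq_rat]
  rfl

/-! ### The negative lemma -/

/-- **A compact degenerate door exists**: a closed (compact, Hausdorff, second countable), connected,
`ℝ⁴`-charted `C^∞` 4-manifold — `ℝP² × T²`, built as the product manifold `(ℝP² × S¹) × S¹`
re-charted on `ℝ⁴` along `(ℝ² × ℝ¹) × ℝ¹ ≃L[ℝ] ℝ⁴` — carrying a smooth closed `MForm` of degree 2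
(the zero form) with `(rank H₁, rank H₂) = (2, 1)`. [folklore] -/
theorem exists_compact_degenerate_door :
    ∃ (N : Type) (_ : TopologicalSpace N) (_ : T2Space N) (_ : SecondCountableTopology N)
      (_ : CompactSpace N) (_ : ConnectedSpace N) (_ : ChartedSpace (EuclideanSpace ℝ (Fin 4)) N)
      (_ : IsManifold (𝓡 4) ∞ N) (s : MForm (𝓡 4) N ℝ 2),
      IsSmoothForm s ∧ IsClosedForm s ∧
      Module.finrank ℤ (singularHomologyZ N 1) = 2 ∧
      Module.finrank ℤ (singularHomologyZ N 2) = 1 := by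
  -- the change of model `(ℝ² × ℝ¹) × ℝ¹ ≃ ℝ⁴` and the re-charted product
  let L : ((EuclideanSpace ℝ (Fin 2) × EuclideanSpace ℝ (Fin 1)) × EuclideanSpace ℝ (Fin 1)) ≃L[ℝ]
      EuclideanSpace ℝ (Fin 4) :=
    ContinuousLinearEquiv.ofFinrankEq (by simp)
  let f : ModelProd (ModelProd (EuclideanSpace ℝ (Fin 2)) (EuclideanSpace ℝ (Fin 1)))
      (EuclideanSpace ℝ (Fin 1)) ≃ₜ EuclideanSpace ℝ (Fin 4) :=
    L.toHomeomorph
  let X : Type := (RealProjectiveSpace 2 × Circle) × Circle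
  let Q : Type := Rechart f X
  have hIf : ∀ x, f x = L ((((𝓡 2).prod (𝓡 1)).prod (𝓡 1)) x) := fun x => rfl
  have hf := Rechart.contMDiff_of_apply_eq_linear (I := ((𝓡 2).prod (𝓡 1)).prod (𝓡 1)) (n := ∞)
    f L hIf
  have hf' := Rechart.contMDiff_symm_of_apply_eq_linear (I := ((𝓡 2).prod (𝓡 1)).prod (𝓡 1))
    (n := ∞) f L hIf
  have hQ : IsManifold (𝓡 4) ∞ Q := Rechart.isManifold f X hf hf'
  haveI : SecondCountableTopology Q := inferInstanceAs (SecondCountableTopology X)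
  haveI := RealProjectiveSpace.pathConnectedSpace 2 (by norm_num)
  haveI : ConnectedSpace Q := inferInstanceAs (ConnectedSpace X)
  -- `Q ≃ₜ (ℝP² × ℝ/ℤ) × ℝ/ℤ`
  let h : Circle ≃ₜ AddCircle (1 : ℝ) := (AddCircle.homeomorphCircle one_ne_zero).symm
  let φ : Q ≃ₜ (RealProjectiveSpace 2 × AddCircle (1 : ℝ)) × AddCircle (1 : ℝ) :=
    (Rechart.outHomeomorph f X).trans
      (((Homeomorph.refl (RealProjectiveSpace 2)).prodCongr h).prodCongr h)
  refine ⟨Q, inferInstance, inferInstance, inferInstance, inferInstance, inferInstance,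
    inferInstance, hQ, 0, isSmoothForm_zero, mextDeriv_zero, ?_, ?_⟩
  · rw [finrank_singularHomologyZ_eq_bettiNumber_rat_of_homeomorph φ,
      bettiNumber_rat_RP2_prodCircle_prodCircle_one]
  · rw [finrank_singularHomologyZ_eq_bettiNumber_rat_of_homeomorph φ,
      bettiNumber_rat_RP2_prodCircle_prodCircle_two]

/-- **Non-degeneracy is load-bearing for `NoGenusTwoDoor`**: the crux with the hypothesis
`∀ x v, v ≠ 0 → ∃ w, s x ![v, w] ≠ 0` deleted (verbatim otherwise) is FALSE, refuted by the zero
form on `ℝP² × T²`. Any proof of the crux must use non-degeneracy (at the very least through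
orientability / `b⁺ ≥ 1`). [folklore] -/
theorem noGenusTwoDoor_false_without_nondegenerate :
    ¬ ∀ (N : Type) [TopologicalSpace N] [T2Space N] [SecondCountableTopology N] [CompactSpace N]
        [ConnectedSpace N] [ChartedSpace (EuclideanSpace ℝ (Fin 4)) N] [IsManifold (𝓡 4) ∞ N]
        (s : MForm (𝓡 4) N ℝ 2), IsSmoothForm s → IsClosedForm s →
        ¬ (Module.finrank ℤ (singularHomologyZ N 1) = 2 ∧
            Module.finrank ℤ (singularHomologyZ N 2) = 1) := by
  intro h
  obtain ⟨N, _, _, _, _, _, _, _, s, hs, hc, h1, h2⟩ := exists_compact_degenerate_door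
  exact h N s hs hc ⟨h1, h2⟩

end Summit.SmoothPoincare4.SmoothPoincare4.Theorems.NoGenusTwoDoor.Negative

end
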